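import Summits.BirchSwinnertonDyer.BirchSwinnertonDyer.Theorems.SignedLowerHalvesSmallImageLowerHalfBothSignsRttD2TwistLevel
import HarnessLib

/-!
# Route `SignedLowerHalves`, crux L `SmallImageLowerHalfBothSigns` (stmt-BirchSwinnertonDyer-23599), line `rtt_w3` v14 — E2, row «D-tw-coh» part 1b(i):
# the level twist is an ISOMORPHISM

INPUTS hand `bsd-inputs-honda-p1` g23 (LEAD g11 RULING «U» (U5); sequel of `…RttD2TwistLevel`, part 1a: `levelTwistO`). For characters `θ, θ'` congruent mod `p^k`
on the level subgroup `U` and on `N_P`: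
* ★★ `levelTwistO_levelTwistO` — `tw_{θ'⇝θ} ∘ tw_{θ⇝θ'} = id` (`H^i(f ≫ g) = H^i(f) ≫ H^i(g)`, `H^i(𝟙) = 𝟙`; the composite coefficient morphism is pointwise the identity),
  packaged as ★★ `levelTwistEquivO : levelCohO S P θ U k i ≃+ levelCohO S P θ' U k i`.
Sequel `…RttD2TwistLevelNaturality` (part 1b(ii)): compatibility with reductions and constants. NOT here (part 2 of «D-tw-coh», L): naturality with the
corestrictions `relCoresO`, the conj-SEMILINEARITY by `η(γ)`, and the cofinal assembly on the pinned data.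
One THEOREM + one `def`; no named fact, no `sorry`; crux L, crux M, E2 and BSD remain OPEN and are proved for NO curve by any of this.
References: [SerreGaloisCohomology1997] I §2.2; [Rubin2000] Ch. VI §6.1–6.2.
-/

set_option autoImplicit false
-- the Theorems namespace of this sub repeats the summit name by design (D-0017 nested layout)
set_option linter.dupNamespace false

noncomputable section

open scoped NumberField TensorProduct
open CategoryTheory Field IsDedekindDomain
open Literature.NumberTheory.GaloisRepresentations
open Literature.NumberTheory.GaloisRepresentations.DiscreteGaloisModule
open Literature.NumberTheory.EllipticCurves
open Literature.NumberTheory.ComplexMultiplication.EllipticUnits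
open Literature.NumberTheory.ComplexMultiplication.EllipticUnits.JohnsonLeungKings2011

namespace Summit.BirchSwinnertonDyer.BirchSwinnertonDyer.Theorems.SmallImageRttD2Twist

variable {K : Type} [Field K] [NumberField K] {p : ℕ} [Fact p.Prime] (S : Set (PadicAlgCl p))
  (P : Set (HeightOneSpectrum (𝓞 K))) (θ θ' : absoluteGaloisGroup K →ₜ* (padicCoeffIntegers S)ˣ) (k : ℕ)
  (hN : ∀ σ ∈ ramificationSubgroup K P, ∃ b : padicCoeffIntegers S,
    ((θ' σ : (padicCoeffIntegers S)ˣ) : padicCoeffIntegers S) = (θ σ : (padicCoeffIntegers S)ˣ) + ((p : padicCoeffIntegers S)) ^ k * b)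
  (U : Subgroup (absoluteGaloisGroup K))
  (hU : ∀ σ ∈ U, ∃ b : padicCoeffIntegers S,
    ((θ' σ : (padicCoeffIntegers S)ˣ) : padicCoeffIntegers S) = (θ σ : (padicCoeffIntegers S)ˣ) + ((p : padicCoeffIntegers S)) ^ k * b)

set_option maxHeartbeats 400000 in
omit [NumberField K] in
/-- ★★ **The two twists are mutually inverse**: `tw_{θ'⇝θ} (tw_{θ⇝θ'} y) = y` (the composite coefficient morphism is the identity; `H^i(f ≫ g) = H^i(f) ≫ H^i(g)`, `H^i(𝟙) = 𝟙`).
[cite: SerreGaloisCohomology1997, I §2.2] [cite: Rubin2000, Ch. VI §6.1–6.2] -/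
theorem levelTwistO_levelTwistO (i : ℕ) (y : levelCohO S P θ U k i) :
    levelTwistO S P θ' θ k (congr_symm_forall S θ θ' k hN) U (congr_symm_forall S θ θ' k hU) i (levelTwistO S P θ θ' k hN U hU i y) = y := by
  have h := (congrArg (fun φ ↦ φ.hom y) (continuousCohomology_map_comp (twistLevelHomO S P θ θ' k hN U hU)
      (twistLevelHomO S P θ' θ k (congr_symm_forall S θ θ' k hN) U (congr_symm_forall S θ θ' k hU)) i)).symm.trans
    (congrArg (fun φ ↦ φ.hom y) (continuousCohomology_map_eq_id _ (twistLevelHomO S P θ θ' k hN U hU ≫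
      twistLevelHomO S P θ' θ k (congr_symm_forall S θ θ' k hN) U (congr_symm_forall S θ θ' k hU)) rfl (fun _ ↦ rfl) i))
  exact h

/-- ★★ **The level twist as an additive isomorphism** `H^i(G_P(F), 𝒪 ⊗ μ_{p^k} ⊗ θ) ≃+ H^i(G_P(F), 𝒪 ⊗ μ_{p^k} ⊗ θ')`.
[cite: SerreGaloisCohomology1997, I §2.2] [cite: Rubin2000, Ch. VI §6.1–6.2] -/
def levelTwistEquivO (i : ℕ) : levelCohO S P θ U k i ≃+ levelCohO S P θ' U k i :=
  { levelTwistO S P θ θ' k hN U hU i with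
    invFun := levelTwistO S P θ' θ k (congr_symm_forall S θ θ' k hN) U (congr_symm_forall S θ θ' k hU) i
    left_inv := fun y ↦ levelTwistO_levelTwistO S P θ θ' k hN U hU i y
    right_inv := fun y ↦ levelTwistO_levelTwistO S P θ' θ k (congr_symm_forall S θ θ' k hN) U (congr_symm_forall S θ θ' k hU) i y }


end Summit.BirchSwinnertonDyer.BirchSwinnertonDyer.Theorems.SmallImageRttD2Twist

end
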